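import Summits.QuantumFields.YangMills.Theorems.BalabanUVNodesN11CondLawInFibreChart

/-!
# DAG node N11 — WINDOWED FIBRE CHARTS COMPOSE WITH UN-CHARTED DISINTEGRATIONS (kernel level): the chart of the joint law of `(f U, U)` on a window, followed by
# the true disintegration of the middle reference along `g`, IS a chart of the joint law of `((g ∘ f) U, U)` — the shape of [III] §3's separated presentation

HEADER — WORK-UNIT METADATA.  Cell `pub-ymgap`, YM-PLAN Track A (HUMAN RULING D-0062), seat `pub-ymgap-dag-n08-w2` (g7; WIDTH SEAT 2∕4 on N08 [B10],
RE-POINTED to N11's [III] §3-supply residue), route `BalabanUVNodes` rev 25, item K1⁷ `StabilityBAtRecordR13SepCoPH` = stmt-QuantumFields-20542 (helper lane,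
`--kind proof --supports 20542 --as helper`, count-neutral).  [I] = [Balaban1987RG1], [III] = [Balaban1988Convergent], [15] = [Balaban1985Variational].
FILE 3 of this seat's kernel-level socket (FILE 1 `…N11CondLawInFibreChart` p611747 ✓, FILE 2 `…N11TStepInFibreChart` p613290 ✓).  Over node00-def-T's
`T4AveragingDisintegration` (`jointLaw`, `margDensity`, `condLaw`, `jointLaw_eq_withDensity_compProd`) and Mathlib's kernel composition-product (`Kernel.compProd`,
`Kernel.withDensity`, `Kernel.prodMkLeft`).  Companion (per-density, NOT restated): dag-n11-w2 g3's `…KernelTransportSkewProduct.kernelTransport_comp_ae_eq` (transitivity of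
def-T's `kernelTransport` for ONE density) and dag-n11-d g14's `…KernelTransportSkewInnerChart` (the charted-inner skew endpoint, one density, fixed charted set).

WHY THIS FILE.  [III] §3 pp. 267–270 computes the one-step transform `∫dU δ(ŪV⁻¹) …` in a SEPARATED presentation: the variables INSIDE the new small-field region are charted
(axial gauge ∘ exponential chart at the `V`-dependent background ∘ the linearising transformation (47) of [15]) — a chart whose window depends on `V` —, while the OUTSIDE
variables are transported by the TRUE, un-charted conditional law (11a's restricted kernel; def-T's `condLaw`).  In map form: `avg = g ∘ f` with `f U := (U_out, avg_rest U)`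
CHARTED on a window and `g := avg_out × id` UN-CHARTED.  FILE 1's kernel-level socket asks ONE hypothesis `hchart` for the WHOLE averaging; THIS FILE shows it is supplied
by a windowed chart for `f` alone: a fibre chart `(X, κ_f, Ψ_f, J_f)` of the joint law of `(f U, U)` on a window `𝒮_f ⊆ γ × β` with respect to a middle reference `λ`,
  `hchartf : ((λ ⊗ₘ κ_f).withDensity J_f).map (z ↦ (z.1, Ψ_f z)) = (jointLaw ν f).restrict 𝒮_f`,
and def-T's disintegration of `λ` along `g` (`λ.map g ≪ μ`; NO chart: the fibre reference absorbs the conditional law `condLaw λ g` weighted by `margDensity λ μ g`) GIVE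
  `((μ ⊗ₘ κ).withDensity J).map (z ↦ (z.1, Ψ z)) = (jointLaw ν (g ∘ f)).restrict 𝒮`
with the COMPOSITE chart `κ := (Kernel.withDensity (condLaw λ g) (margDensity λ μ g)) ⊗ₖ Kernel.prodMkLeft α κ_f : Kernel α (γ × X)`, `Ψ (V,(w,x)) := Ψ_f (w,x)`,
`J (V,(w,x)) := J_f (w,x)`, window `𝒮 := {(V, U) | (f U, U) ∈ 𝒮_f}`.  So FILE 1's ★★★ (`condLaw_restrict_window_ae_eq_chart`, `ae_forall_kernelTransport_eq_chart`: EVERY density at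
once, `V`-dependent windows) apply to `g ∘ f`, with the chart integral the ITERATED fibre integral `h_g(V) · ∫ dcondLaw_g(V)(w) ∫ J_f(w,x)·ρ(Ψ_f(w,x)) κ_f(w,dx)` (§2).

WHAT THIS FILE PROVES (0 `def`, 0 `sorry`, standard axioms; generic `{α β γ X}`).
§1 `lintegral_margDensity_mul_lintegral_condLaw_eq_lintegral_graph` (def-T's disintegration in `∫⁻` form for a JOINTLY measurable integrand `Φ(V, w)`) · `lintegral_map_withDensity_compChart`
   (Tonelli for the composite chart measure) · ★★★ `chart_comp_of_disintegration`.
§2 ★★ `ae_forall_lintegral_kernelTransport_comp_eq` (the composite's every-`ℝ≥0∞`-density identity with the iterated fibre integral written out).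
§3 `lintegral_lintegral_condLaw_map` · ★★ `condLaw_prod_map_id_ae_eq` (the un-charted OUTER step `g = a₁ × id` of the separated presentation:
   `condLaw (ν₁ ⊗ μ₂) (a₁ × id) (v₁,v₂) = condLaw ν₁ a₁ v₁ ⊗ δ_{v₂}` a.e., by Mathlib's uniqueness of disintegration).

HONEST FRAMING.  Helper lane of K1⁷; count-neutral; pure finite measure theory (Tonelli for `μ ⊗ₘ (κ₁ ⊗ₖ η)`, `withDensity`, push-forward, `Measure.ext_of_lintegral`) over
def-T's definitions and FILE 1; NO chart constructed, NO Jacobian computed; nothing of Bałaban ([I] §2, [III] §3 (3.10)–(3.25), [15] (47)–(49)) asserted; (S-α) ∕ (B4) NOT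
closed; N11 NOT discharged; N08 untouched; K1⁷ NOT closed; counts unmoved (typed 28∕28 · discharged 5∕27).  One finite `𝕋⁴_{L^K}` programme at fixed `ε = L^{−K}`; R4 closes
only the conditional finite-𝕋⁴ rung `BalabanLadder.UV` — NOT ℝ⁴, NOT OS, NOT a mass gap, NOT Clay.  No `sorry`, `axiom`, `def`, `instance`, `notation`.  Sources (SHAPE ∕
bookkeeping only): [I] (0.4) p.253; [III] (2.21) p.258, (3.1) p.264, (3.10)–(3.11) p.266, p.267 L18–24, p.270 L3–6; [15] (47)–(49) pp.287–288.
-/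

noncomputable section

open MeasureTheory ProbabilityTheory
open scoped ENNReal NNReal

namespace Summit.QuantumFields.YangMills.Theorems.BalabanUVNodesN11CondLawInFibreChartComposition

open Literature.MathematicalPhysics.QuantumFieldTheory.Balaban1983to89
open Literature.MathematicalPhysics.QuantumFieldTheory.Balaban1983to89.T4AveragingDisintegration
open BalabanUVNodesN11CondLawInFibreChart

/-! ## §1  The composite chart and its push-forward identity -/

section Composition

variable {α β γ X : Type*} [MeasurableSpace α] [MeasurableSpace β] [MeasurableSpace γ] [MeasurableSpace X]
variable [StandardBorelSpace γ] [Nonempty γ]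
variable {ν : Measure β} {lam : Measure γ} [IsFiniteMeasure lam] {μ : Measure α} [SigmaFinite μ]
variable {f : β → γ} {g : γ → α} {κf : Kernel γ X} [IsSFiniteKernel κf] {Ψf : γ × X → β} {Jf : γ × X → ℝ≥0} {𝒮f : Set (γ × β)}

omit [IsSFiniteKernel κf] in
/-- **def-T's DISINTEGRATION OF `λ` ALONG `g`, `ℝ≥0∞` FORM, JOINTLY MEASURABLE INTEGRAND**: `∫ h_g(V) · (∫ Φ(V, w) condLaw_g(V, dw)) dμ = ∫ Φ(g w, w) dλ` for every measurable
`Φ ≥ 0` on `α × γ` (`jointLaw_eq_withDensity_compProd` + Tonelli; the `w`-only case is dag-n11-d's `lintegral_margDensity_mul_lintegral_condLaw`).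
[cite: Balaban1987RG1, (0.4) p.253; Balaban1988Convergent, (3.1) p.264 (bookkeeping: the disintegration identity)] -/
theorem lintegral_margDensity_mul_lintegral_condLaw_eq_lintegral_graph (hg : Measurable g) (hacg : lam.map g ≪ μ) {Φ : α × γ → ℝ≥0∞} (hΦ : Measurable Φ) :
    ∫⁻ V, (margDensity lam μ g V : ℝ≥0∞) * ∫⁻ w, Φ (V, w) ∂(condLaw lam g V) ∂μ = ∫⁻ w, Φ (g w, w) ∂lam := by
  have hm : Measurable fun V => (margDensity lam μ g V : ℝ≥0∞) := measurable_margDensity.coe_nnreal_ennreal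
  have hm2 : Measurable fun r : α × γ => (margDensity lam μ g r.1 : ℝ≥0∞) * Φ r := (hm.comp measurable_fst).mul hΦ
  symm
  calc ∫⁻ w, Φ (g w, w) ∂lam = ∫⁻ r, Φ r ∂(jointLaw lam g) := by rw [jointLaw, lintegral_map hΦ (measurable_graphMap hg)]
    _ = ∫⁻ r, Φ r ∂((μ ⊗ₘ condLaw lam g).withDensity fun r => (margDensity lam μ g r.1 : ℝ≥0∞)) := by
        rw [← jointLaw_eq_withDensity_compProd lam μ hg hacg]
    _ = ∫⁻ r, (margDensity lam μ g r.1 : ℝ≥0∞) * Φ r ∂(μ ⊗ₘ condLaw lam g) :=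
        lintegral_withDensity_eq_lintegral_mul _ (show Measurable (fun r : α × γ => (margDensity lam μ g r.1 : ℝ≥0∞)) from hm.comp measurable_fst) hΦ
    _ = ∫⁻ V, ∫⁻ w, (margDensity lam μ g V : ℝ≥0∞) * Φ (V, w) ∂(condLaw lam g V) ∂μ := Measure.lintegral_compProd hm2
    _ = ∫⁻ V, (margDensity lam μ g V : ℝ≥0∞) * ∫⁻ w, Φ (V, w) ∂(condLaw lam g V) ∂μ :=
        lintegral_congr fun V => lintegral_const_mul _ (show Measurable (fun w => Φ (V, w)) from hΦ.comp measurable_prodMk_left)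

/-- **TONELLI FOR THE COMPOSITE CHART MEASURE**: with `κ := (condLaw λ g weighted by margDensity λ μ g) ⊗ₖ prodMkLeft α κ_f`, for every measurable `G ≥ 0` on `α × β`,
`∫ G d(((μ ⊗ₘ κ).withDensity J).map (z ↦ (z.1, Ψ_f z.2))) = ∫dμ(V) h_g(V) ∫ condLaw_g(V,dw) ∫ κ_f(w,dx) J_f(w,x) · G(V, Ψ_f(w,x))`.
[cite: Balaban1988Convergent, (3.1) p.264, p.267 L18–24, p.270 L3–6 (bookkeeping: the iterated integral of the separated presentation)] -/
theorem lintegral_map_withDensity_compChart (hΨf : Measurable Ψf) (hJf : Measurable Jf) {G : α × β → ℝ≥0∞} (hG : Measurable G) :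
    ∫⁻ p, G p ∂(((μ ⊗ₘ ((Kernel.withDensity (condLaw lam g) fun V _ => (margDensity lam μ g V : ℝ≥0∞)) ⊗ₖ Kernel.prodMkLeft α κf)).withDensity
        (fun z => (Jf z.2 : ℝ≥0∞))).map (fun z => (z.1, Ψf z.2))) =
      ∫⁻ V, (margDensity lam μ g V : ℝ≥0∞) * ∫⁻ w, ∫⁻ x, (Jf (w, x) : ℝ≥0∞) * G (V, Ψf (w, x)) ∂(κf w) ∂(condLaw lam g V) ∂μ := by
  have hφ : Measurable fun z : α × (γ × X) => (z.1, Ψf z.2) := measurable_fst.prodMk (hΨf.comp measurable_snd)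
  have hJ : Measurable fun z : α × (γ × X) => (Jf z.2 : ℝ≥0∞) := (hJf.comp measurable_snd).coe_nnreal_ennreal
  have hF : Measurable fun z : α × (γ × X) => (Jf z.2 : ℝ≥0∞) * G (z.1, Ψf z.2) := hJ.mul (hG.comp hφ)
  have hdens : Measurable (Function.uncurry fun (V : α) (_ : γ) => (margDensity lam μ g V : ℝ≥0∞)) :=
    measurable_margDensity.coe_nnreal_ennreal.comp measurable_fst
  rw [lintegral_map hG hφ,
    lintegral_withDensity_eq_lintegral_mul _ hJ (show Measurable (fun z : α × (γ × X) => G (z.1, Ψf z.2)) from hG.comp hφ)]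
  change ∫⁻ z, (Jf z.2 : ℝ≥0∞) * G (z.1, Ψf z.2) ∂(μ ⊗ₘ _) = _
  rw [Measure.lintegral_compProd hF]
  refine lintegral_congr fun V => ?_
  have hFV : Measurable fun q : γ × X => (Jf q : ℝ≥0∞) * G (V, Ψf q) :=
    hJf.coe_nnreal_ennreal.mul (hG.comp (measurable_const.prodMk hΨf))
  change ∫⁻ q, (Jf q : ℝ≥0∞) * G (V, Ψf q) ∂(((Kernel.withDensity (condLaw lam g) fun V _ => (margDensity lam μ g V : ℝ≥0∞)) ⊗ₖ
      Kernel.prodMkLeft α κf) V) = _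
  rw [Kernel.lintegral_compProd _ _ _ hFV]
  have hinner : Measurable fun w => ∫⁻ x, (Jf (w, x) : ℝ≥0∞) * G (V, Ψf (w, x)) ∂(Kernel.prodMkLeft α κf (V, w)) := by
    have h := (show Measurable fun z : (α × γ) × X => (Jf (z.1.2, z.2) : ℝ≥0∞) * G (z.1.1, Ψf (z.1.2, z.2)) by fun_prop).lintegral_kernel_prod_right'
      (κ := Kernel.prodMkLeft α κf)
    exact h.comp measurable_prodMk_left
  rw [Kernel.lintegral_withDensity _ hdens V hinner]
  rw [lintegral_const_mul _ hinner]
  rfl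

/-- **★★★ WINDOWED FIBRE CHARTS COMPOSE WITH UN-CHARTED DISINTEGRATIONS (kernel level)**: a fibre chart `(X, κ_f, Ψ_f, J_f)` of the joint law of `(f U, U)` on the window
`𝒮_f` with respect to the middle reference `λ` (`hchartf`), followed by def-T's disintegration of `λ` along `g` (`λ.map g ≪ μ`), IS a fibre chart of the joint law of
`((g ∘ f) U, U)` with respect to `μ`, with fibre reference the composition-product kernel `(condLaw λ g weighted by margDensity λ μ g) ⊗ₖ prodMkLeft α κ_f`, the same chart map
and Jacobian read on the inner coordinates, and the window `{(V, U) | (f U, U) ∈ 𝒮_f}`: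
`((μ ⊗ₘ κ).withDensity J).map (z ↦ (z.1, Ψ_f z.2)) = (jointLaw ν (g ∘ f)).restrict {(V,U) | (f U, U) ∈ 𝒮_f}` — FILE 1's hypothesis `hchart` for `g ∘ f`.  Both sides have
the same integral of every measurable `G ≥ 0` (§1's two Tonelli identities + `hchartf` as a push-forward identity), then `Measure.ext_of_lintegral`.  This is the shape of
[III] §3's SEPARATED PRESENTATION: inside variables charted (`f`), outside variables transported by the true conditional law (`g`).
[cite: Balaban1987RG1, (0.4) p.253, Sect. 2 pp.260–262; Balaban1988Convergent, (2.21) p.258, (3.1) p.264, (3.10)–(3.11) p.266, p.267 L18–24, p.270 L3–6; Balaban1985Variational, (47)–(49) pp.287–288] -/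
theorem chart_comp_of_disintegration (hf : Measurable f) (hg : Measurable g) (hacg : lam.map g ≪ μ) (hΨf : Measurable Ψf) (hJf : Measurable Jf)
    (h𝒮f : MeasurableSet 𝒮f)
    (hchartf : ((lam ⊗ₘ κf).withDensity (fun z => (Jf z : ℝ≥0∞))).map (fun z => (z.1, Ψf z)) = (jointLaw ν f).restrict 𝒮f) :
    ((μ ⊗ₘ ((Kernel.withDensity (condLaw lam g) fun V _ => (margDensity lam μ g V : ℝ≥0∞)) ⊗ₖ Kernel.prodMkLeft α κf)).withDensity
        (fun z => (Jf z.2 : ℝ≥0∞))).map (fun z => (z.1, Ψf z.2)) =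
      (jointLaw ν (g ∘ f)).restrict ((fun p : α × β => (f p.2, p.2)) ⁻¹' 𝒮f) := by
  refine Measure.ext_of_lintegral _ fun G hG => ?_
  rw [lintegral_map_withDensity_compChart hΨf hJf hG]
  -- the right side: `∫ 1_{𝒮_f}(f U, U) · G(g (f U), U) dν`
  have hpre : Measurable fun p : α × β => (f p.2, p.2) := (hf.comp measurable_snd).prodMk measurable_snd
  have hR : ∫⁻ p, G p ∂((jointLaw ν (g ∘ f)).restrict ((fun p : α × β => (f p.2, p.2)) ⁻¹' 𝒮f)) =
      ∫⁻ U, 𝒮f.indicator (fun _ => (1 : ℝ≥0∞)) (f U, U) * G (g (f U), U) ∂ν := by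
    rw [← lintegral_indicator (hpre h𝒮f), jointLaw, lintegral_map ((hG.indicator (hpre h𝒮f))) (measurable_graphMap (hg.comp hf))]
    refine lintegral_congr fun U => ?_
    by_cases hU : (f U, U) ∈ 𝒮f
    · rw [Set.indicator_of_mem (show ((g ∘ f) U, U) ∈ (fun p : α × β => (f p.2, p.2)) ⁻¹' 𝒮f from hU), Set.indicator_of_mem hU, one_mul]
      rfl
    · rw [Set.indicator_of_notMem (show ((g ∘ f) U, U) ∉ (fun p : α × β => (f p.2, p.2)) ⁻¹' 𝒮f from hU), Set.indicator_of_notMem hU, zero_mul]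
  -- the left side, inner part: the chart for `f` as a push-forward identity, at the integrand `(w, u) ↦ G(g w, u)` cut down to the window
  set Φ : α × γ → ℝ≥0∞ := fun r => ∫⁻ x, (Jf (r.2, x) : ℝ≥0∞) * G (r.1, Ψf (r.2, x)) ∂(κf r.2) with hΦdef
  have hΦ : Measurable Φ := by
    have h := (show Measurable fun z : (α × γ) × X => (Jf (z.1.2, z.2) : ℝ≥0∞) * G (z.1.1, Ψf (z.1.2, z.2)) by fun_prop).lintegral_kernel_prod_right'
      (κ := Kernel.prodMkLeft α κf)
    exact h
  have hL1 : ∫⁻ V, (margDensity lam μ g V : ℝ≥0∞) * ∫⁻ w, ∫⁻ x, (Jf (w, x) : ℝ≥0∞) * G (V, Ψf (w, x)) ∂(κf w) ∂(condLaw lam g V) ∂μ =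
      ∫⁻ w, Φ (g w, w) ∂lam :=
    lintegral_margDensity_mul_lintegral_condLaw_eq_lintegral_graph hg hacg hΦ
  have hGg : Measurable fun r : γ × β => 𝒮f.indicator (fun _ => (1 : ℝ≥0∞)) r * G (g r.1, r.2) :=
    (measurable_const.indicator h𝒮f).mul (hG.comp ((hg.comp measurable_fst).prodMk measurable_snd))
  have hL2 : ∫⁻ w, Φ (g w, w) ∂lam = ∫⁻ r, 𝒮f.indicator (fun _ => (1 : ℝ≥0∞)) r * G (g r.1, r.2) ∂(jointLaw ν f) := by
    -- `∫ Φ(g w, w) dλ = ∫ J_f · G(g z.1, Ψ_f z) d(λ ⊗ₘ κ_f) = ∫ G(g r.1, r.2) d(chart measure) = ∫_{𝒮_f} G(g r.1, r.2) d(jointLaw ν f)`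
    have e1 : ∫⁻ w, Φ (g w, w) ∂lam = ∫⁻ z, (Jf z : ℝ≥0∞) * G (g z.1, Ψf z) ∂(lam ⊗ₘ κf) := by
      rw [Measure.lintegral_compProd (show Measurable fun z : γ × X => (Jf z : ℝ≥0∞) * G (g z.1, Ψf z) by fun_prop)]
    have e2 : ∫⁻ z, (Jf z : ℝ≥0∞) * G (g z.1, Ψf z) ∂(lam ⊗ₘ κf) =
        ∫⁻ r, G (g r.1, r.2) ∂(((lam ⊗ₘ κf).withDensity (fun z => (Jf z : ℝ≥0∞))).map (fun z => (z.1, Ψf z))) := by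
      rw [lintegral_map (show Measurable (fun r : γ × β => G (g r.1, r.2)) from hG.comp ((hg.comp measurable_fst).prodMk measurable_snd))
          (measurable_fst.prodMk hΨf),
        lintegral_withDensity_eq_lintegral_mul _ (show Measurable fun z : γ × X => (Jf z : ℝ≥0∞) by fun_prop)
          (show Measurable fun z : γ × X => G (g z.1, Ψf z) by fun_prop)]
      rfl
    rw [e1, e2, hchartf, ← lintegral_indicator h𝒮f]
    refine lintegral_congr fun r => ?_
    by_cases hr : r ∈ 𝒮f
    · rw [Set.indicator_of_mem hr, Set.indicator_of_mem hr, one_mul]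
    · rw [Set.indicator_of_notMem hr, Set.indicator_of_notMem hr, zero_mul]
  have hL3 : ∫⁻ r, 𝒮f.indicator (fun _ => (1 : ℝ≥0∞)) r * G (g r.1, r.2) ∂(jointLaw ν f) =
      ∫⁻ U, 𝒮f.indicator (fun _ => (1 : ℝ≥0∞)) (f U, U) * G (g (f U), U) ∂ν := by
    rw [jointLaw, lintegral_map hGg (measurable_graphMap hf)]
  rw [hL1, hL2, hL3, hR]

end Composition

/-! ## §2  The composite's every-density identity, with the iterated fibre integral written out -/

section Consequence

variable {α β γ X : Type*} [MeasurableSpace α] [MeasurableSpace β] [MeasurableSpace γ] [MeasurableSpace X]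
variable [StandardBorelSpace β] [Nonempty β] [StandardBorelSpace γ] [Nonempty γ]
variable {ν : Measure β} [IsFiniteMeasure ν] {lam : Measure γ} [IsFiniteMeasure lam] {μ : Measure α} [SigmaFinite μ]
variable {f : β → γ} {g : γ → α} {κf : Kernel γ X} [IsSFiniteKernel κf] {Ψf : γ × X → β} {Jf : γ × X → ℝ≥0} {𝒮f : Set (γ × β)}

/-- **★★ THE CONDITIONAL LAW ALONG `g ∘ f` ON THE WINDOW, EVERY `ℝ≥0∞`-DENSITY AT ONCE, AS AN ITERATED FIBRE INTEGRAL**: under the hypotheses of ★★★ and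
`ν.map (g ∘ f) ≪ μ`, for `μ`-a.e. `V` and EVERY measurable `ρ ≥ 0` on `β`,
`margDensity ν μ (g∘f) V · ∫_{U : (f U, U) ∈ 𝒮_f} ρ dcondLaw(ν, g∘f)(V) = h_g(V) · ∫ condLaw_g(V, dw) ∫ κ_f(w, dx) J_f(w,x) · ρ(Ψ_f(w,x))` — FILE 1's
`ae_forall_lintegral_condLaw_eq_chart` at the composite chart, the composition-product integral unfolded (`Kernel.lintegral_compProd`, `Kernel.lintegral_withDensity`).
[cite: Balaban1987RG1, (0.4) p.253; Balaban1988Convergent, (3.1) p.264, (3.10)–(3.11) p.266, p.267 L18–24, p.270 L3–6] -/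
theorem ae_forall_lintegral_kernelTransport_comp_eq (hf : Measurable f) (hg : Measurable g) (hacg : lam.map g ≪ μ) (hac : ν.map (g ∘ f) ≪ μ)
    (hΨf : Measurable Ψf) (hJf : Measurable Jf) (h𝒮f : MeasurableSet 𝒮f)
    (hchartf : ((lam ⊗ₘ κf).withDensity (fun z => (Jf z : ℝ≥0∞))).map (fun z => (z.1, Ψf z)) = (jointLaw ν f).restrict 𝒮f) :
    ∀ᵐ V ∂μ, ∀ ρ : β → ℝ≥0∞, Measurable ρ →
      (margDensity ν μ (g ∘ f) V : ℝ≥0∞) * ∫⁻ U in Prod.mk V ⁻¹' ((fun p : α × β => (f p.2, p.2)) ⁻¹' 𝒮f), ρ U ∂(condLaw ν (g ∘ f) V) =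
        (margDensity lam μ g V : ℝ≥0∞) * ∫⁻ w, ∫⁻ x, (Jf (w, x) : ℝ≥0∞) * ρ (Ψf (w, x)) ∂(κf w) ∂(condLaw lam g V) := by
  have hpre : Measurable fun p : α × β => (f p.2, p.2) := (hf.comp measurable_snd).prodMk measurable_snd
  have hdens : Measurable (Function.uncurry fun (V : α) (_ : γ) => (margDensity lam μ g V : ℝ≥0∞)) :=
    measurable_margDensity.coe_nnreal_ennreal.comp measurable_fst
  filter_upwards [ae_forall_lintegral_condLaw_eq_chart (κ := (Kernel.withDensity (condLaw lam g) fun V _ => (margDensity lam μ g V : ℝ≥0∞)) ⊗ₖ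
      Kernel.prodMkLeft α κf) (Ψ := fun z : α × (γ × X) => Ψf z.2) (J := fun z : α × (γ × X) => Jf z.2)
    (hg.comp hf) hac (hΨf.comp measurable_snd) (hJf.comp measurable_snd) (hpre h𝒮f)
    (chart_comp_of_disintegration hf hg hacg hΨf hJf h𝒮f hchartf)] with V hV ρ hρ
  rw [hV ρ hρ]
  have hFV : Measurable fun q : γ × X => (Jf q : ℝ≥0∞) * ρ (Ψf q) := hJf.coe_nnreal_ennreal.mul (hρ.comp hΨf)
  change ∫⁻ q, (Jf q : ℝ≥0∞) * ρ (Ψf q) ∂(((Kernel.withDensity (condLaw lam g) fun V _ => (margDensity lam μ g V : ℝ≥0∞)) ⊗ₖ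
      Kernel.prodMkLeft α κf) V) = _
  rw [Kernel.lintegral_compProd _ _ _ hFV]
  have hinner : Measurable fun w => ∫⁻ x, (Jf (w, x) : ℝ≥0∞) * ρ (Ψf (w, x)) ∂(Kernel.prodMkLeft α κf (V, w)) := by
    have h := (show Measurable fun z : (α × γ) × X => (Jf (z.1.2, z.2) : ℝ≥0∞) * ρ (Ψf (z.1.2, z.2)) by fun_prop).lintegral_kernel_prod_right'
      (κ := Kernel.prodMkLeft α κf)
    exact h.comp measurable_prodMk_left
  rw [Kernel.lintegral_withDensity _ hdens V hinner, lintegral_const_mul _ hinner]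
  rfl

end Consequence

/-! ## §3  The OUTER factor of the separated presentation: the conditional law of a product reference along `a₁ × id` is `condLaw(a₁) ⊗ δ`, a.e. -/

section OuterFactor

variable {α₁ α₂ β₁ : Type*} [MeasurableSpace α₁] [MeasurableSpace α₂] [MeasurableSpace β₁]
variable [StandardBorelSpace β₁] [Nonempty β₁] [StandardBorelSpace α₂] [Nonempty α₂]
variable {ν₁ : Measure β₁} [IsFiniteMeasure ν₁] {μ₂ : Measure α₂} [IsFiniteMeasure μ₂] {a₁ : β₁ → α₁}

/-- def-T's disintegration of `ν₁` along `a₁`, `ℝ≥0∞` form over the IMAGE measure: `∫ d(ν₁.map a₁)(v) ∫ Φ(v, u) condLaw(v, du) = ∫ Φ(a₁ u, u) dν₁` for every measurable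
`Φ ≥ 0` (`fst_compProd_condLaw`). [cite: Balaban1987RG1, (0.4) p.253 (bookkeeping: the disintegration identity)] -/
theorem lintegral_lintegral_condLaw_map (ha₁ : Measurable a₁) {Φ : α₁ × β₁ → ℝ≥0∞} (hΦ : Measurable Φ) :
    ∫⁻ v, ∫⁻ u, Φ (v, u) ∂(condLaw ν₁ a₁ v) ∂(ν₁.map a₁) = ∫⁻ u, Φ (a₁ u, u) ∂ν₁ := by
  rw [← jointLaw_fst ν₁ ha₁, ← Measure.lintegral_compProd hΦ, fst_compProd_condLaw, jointLaw, lintegral_map hΦ (measurable_graphMap ha₁)]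

/-- **★★ THE CONDITIONAL LAW OF A PRODUCT REFERENCE ALONG `a₁ × id` (kernel level)**: for `λ = ν₁ ⊗ μ₂` and `g = Prod.map a₁ id` — the un-charted OUTER step of the
separated presentation (outside variables averaged by `a₁`, the already-coarse rest carried along) —, for `(λ.map g)`-a.e. `(v₁, v₂)`:
`condLaw (ν₁ ⊗ μ₂) (a₁ × id) (v₁, v₂) = (condLaw ν₁ a₁ v₁) ⊗ δ_{v₂}` (as `(condLaw ν₁ a₁ v₁).map (u₁ ↦ (u₁, v₂))`).  Proof: the Markov kernel
`prodMkRight α₂ (condLaw ν₁ a₁) ×ₖ deterministic Prod.snd` disintegrates the joint law of `(g U, U)` over its first marginal `(ν₁.map a₁) ⊗ μ₂` (Tonelli + the previous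
lemma), then Mathlib's uniqueness of disintegration `eq_condKernel_of_measure_eq_compProd` (sibling of `…N14LawChannelPushForwardToy.condLaw_prod_fst_ae`, the case
`a₁ = id` read along `Prod.fst`).  So in §2, at `g = a₁ × id`, the outer conditional integral is `∫ condLaw(ν₁, a₁)(v₁, du₁)` at the fibre point `w = (u₁, v₂)` — dag-n11-d's
skew endpoint shape, at kernel level. [cite: Balaban1987RG1, (0.4) p.253; Balaban1988Convergent, (2.21) p.258, (3.1) p.264, (3.10)–(3.11) p.266 (bookkeeping: outside variables transported by the true conditional law)] -/
theorem condLaw_prod_map_id_ae_eq (ha₁ : Measurable a₁) :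
    ∀ᵐ v ∂((ν₁.map a₁).prod μ₂), condLaw (ν₁.prod μ₂) (Prod.map a₁ id) v = (condLaw ν₁ a₁ v.1).map (fun u₁ => (u₁, v.2)) := by
  set κ : Kernel (α₁ × α₂) (β₁ × α₂) :=
    (Kernel.prodMkRight α₂ (condLaw ν₁ a₁)) ×ₖ (Kernel.deterministic (fun v : α₁ × α₂ => v.2) measurable_snd) with hκ
  have hκapply : ∀ v, κ v = (condLaw ν₁ a₁ v.1).map (fun u₁ => (u₁, v.2)) := by
    intro v
    rw [hκ, Kernel.prod_apply, Kernel.prodMkRight_apply, Kernel.deterministic_apply, Measure.prod_dirac]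
  have hmeas : Measurable (Prod.map a₁ (id : α₂ → α₂)) := ha₁.prodMap measurable_id
  have hfst : (jointLaw (ν₁.prod μ₂) (Prod.map a₁ id)).fst = (ν₁.map a₁).prod μ₂ := by
    rw [jointLaw_fst _ hmeas, ← Measure.map_prod_map _ _ ha₁ measurable_id, Measure.map_id]
  have hdis : jointLaw (ν₁.prod μ₂) (Prod.map a₁ id) = (jointLaw (ν₁.prod μ₂) (Prod.map a₁ id)).fst ⊗ₘ κ := by
    rw [hfst]
    refine Measure.ext_of_lintegral _ fun F hF => ?_
    rw [jointLaw, lintegral_map hF (measurable_graphMap hmeas), Measure.lintegral_compProd hF]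
    -- right side: unfold `κ`, integrate `v₂` first against `μ₂`, swap with the conditional integral, disintegrate `ν₁` along `a₁`
    have e1 : ∀ v : α₁ × α₂, ∫⁻ u, F (v, u) ∂(κ v) = ∫⁻ u₁, F (v, (u₁, v.2)) ∂(condLaw ν₁ a₁ v.1) := by
      intro v
      rw [hκapply v, lintegral_map (show Measurable (fun u : β₁ × α₂ => F (v, u)) from hF.comp measurable_prodMk_left)
        (show Measurable (fun u₁ : β₁ => (u₁, v.2)) from measurable_id.prodMk measurable_const)]
    have hG : Measurable fun p : (α₁ × α₂) × β₁ => F (p.1, (p.2, p.1.2)) := by fun_prop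
    have hG' : Measurable fun q : α₁ × α₂ => ∫⁻ u₁, F (q, (u₁, q.2)) ∂(condLaw ν₁ a₁ q.1) := by
      have h := hG.lintegral_kernel_prod_right' (κ := Kernel.prodMkRight α₂ (condLaw ν₁ a₁))
      simpa only [Kernel.prodMkRight_apply] using h
    calc ∫⁻ u, F ((Prod.map a₁ id) u, u) ∂(ν₁.prod μ₂)
        = ∫⁻ u₁, ∫⁻ v₂, F ((a₁ u₁, v₂), (u₁, v₂)) ∂μ₂ ∂ν₁ := by
          rw [MeasureTheory.lintegral_prod _
            (show Measurable (fun u : β₁ × α₂ => F ((Prod.map a₁ id) u, u)) from hF.comp (measurable_graphMap hmeas)).aemeasurable]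
          rfl
      _ = ∫⁻ v₁, ∫⁻ u₁, ∫⁻ v₂, F ((v₁, v₂), (u₁, v₂)) ∂μ₂ ∂(condLaw ν₁ a₁ v₁) ∂(ν₁.map a₁) := by
          rw [lintegral_lintegral_condLaw_map ha₁
            (show Measurable (fun p : α₁ × β₁ => ∫⁻ v₂, F ((p.1, v₂), (p.2, v₂)) ∂μ₂) from
              (show Measurable fun q : (α₁ × β₁) × α₂ => F ((q.1.1, q.2), (q.1.2, q.2)) by fun_prop).lintegral_prod_right')]
      _ = ∫⁻ v₁, ∫⁻ v₂, ∫⁻ u₁, F ((v₁, v₂), (u₁, v₂)) ∂(condLaw ν₁ a₁ v₁) ∂μ₂ ∂(ν₁.map a₁) := by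
          refine lintegral_congr fun v₁ => ?_
          rw [lintegral_lintegral_swap]
          exact (show Measurable fun q : β₁ × α₂ => F ((v₁, q.2), (q.1, q.2)) by fun_prop).aemeasurable
      _ = ∫⁻ v, ∫⁻ u₁, F (v, (u₁, v.2)) ∂(condLaw ν₁ a₁ v.1) ∂((ν₁.map a₁).prod μ₂) := by
          rw [MeasureTheory.lintegral_prod _ hG'.aemeasurable]
      _ = ∫⁻ v, ∫⁻ u, F (v, u) ∂(κ v) ∂((ν₁.map a₁).prod μ₂) := lintegral_congr fun v => (e1 v).symm
  have key := eq_condKernel_of_measure_eq_compProd κ hdis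
  rw [hfst] at key
  filter_upwards [key] with v hv
  rw [← hκapply v, hv]
  rfl

end OuterFactor

end Summit.QuantumFields.YangMills.Theorems.BalabanUVNodesN11CondLawInFibreChartComposition

end
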